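import Summits.ValiantsHypothesis.ValiantsHypothesis.Theorems.BarrierLeverPartitionMinorsMooreBench

/-!
# Route BarrierLever — item 22038 `ChowBenchmarkPairs`, line `moore-peel`: LEMMA Z′ — the zeta windows
# of the hierarchical Moore peel are UNIMODULAR (`det Z(i,c) = ±1` for every size `i` and every start `c`)

Helper file (`--supports stmt-ValiantsHypothesis-22038`; cell valiant-natproofs, rung V4, 𝒟-side benchmark
of record, line `moore_peel`, card v12 (E)(i); seat val-np-p4 gen 26, kernel form of LEMMA Z′ of the seat's
memo `HOME/val-np-p4/g25/MEMO-valnp4-g25.md` §4bis).  Closes NO item.  Two definitions (`zetaWindow`,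
`zetaPeelMatrix`), otherwise proofs.

SETTING.  Codes are read as bit-sets (`bits`, file `…PartitionMinorsMooreBench`).  The ZETA WINDOW
`Z(i,c) = zetaWindow i c` is the `i × i` Boolean inclusion matrix `Z(i,c)[j,m] = [bits j ⊆ bits (c+m)]`
(`j, m < i`): rows an initial segment of codes, columns the window of `i` consecutive codes starting at
`c`.  The stage-`i` matrix of the hierarchical Moore peel with UNIT weights (the `exp` kernel: midpoint
evaluations instead of segment means, memo §4bis THEOREM M) is `Z_i = Z(i, c_i)` (`zetaPeelMatrix`,
`c_i = windowStart i`); it has the same support as the factorial stage matrix `G_i = peelMatrix i` of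
`…MooreBench` (`peelMatrix_ne_zero_iff`), whose determinant vanishes at `i = 183` (`…MooreBenchStop`).

* **`natAbs_det_zetaWindow` (LEMMA Z′)** — `|det Z(i,c)| = 1` for ALL `i, c`; hence
  `isUnit_det_zetaWindow`, `det_zetaWindow_ne_zero`, and for the peel `natAbs_det_zetaPeelMatrix`,
  **`det_zetaPeelMatrix_ne_zero : (zetaPeelMatrix i).det ≠ 0` for every `i`** — the unit-weight peel
  never stops.
* Mechanism (`natAbs_det_zetaWindow_step`): for `s ≤ 2^k`, `|det Z(2^k + s, c)| = |det Z(2^k, c)| ·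
  |det Z(s, c)|`.  Only the bits below `k+1` of a column code matter for rows `< 2^(k+1)`; the columns
  `m` and `m + 2^k` (`m < s`) have the same residue mod `2^k` and opposite bit `k`.  Reindex rows as
  `Fin (2^k) ⊕ Fin s` (low rows `j < 2^k`, high rows `2^k + j₁`) and columns by the twist `colTwist` that
  puts the bit-`k`-free member of each pair `{m, m + 2^k}` first (`|det|` is invariant,
  `Matrix.abs_det_submatrix_equiv_equiv`).  Then the low block row is `[Z(2^k,c) | Z(2^k,c)·J]`
  (`J` = the first `s` columns of the identity: equal residues give equal low rows), the high rows vanish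
  on the first `s` columns (bit `k` absent) and equal `Z(s,c)` on the last block (bit `k` present, low bits
  those of `c + j'`); one block column operation (right multiplication by the unipotent
  `fromBlocks 1 (-J) 0 1`) makes the matrix block lower-triangular with diagonal blocks `Z(2^k,c)` and
  `Z(s,c)` (`Matrix.det_fromBlocks_zero₁₂`).  Induction on `k` over all `i ≤ 2^k`.

WHAT THIS IS NOT: no stub of line `moore_peel` is closed and nothing is claimed about the segment-mean
benchmark (`stub_segmentMeanValue`), whose factorial stage matrices are NOT unimodular (`det G_183 = 0`);
nothing on crux stmt-ValiantsHypothesis-14610 or on `VP` versus `VNP`.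
-/

set_option linter.dupNamespace false

namespace Summit.ValiantsHypothesis.ValiantsHypothesis.Theorems.BarrierLever.MoorePeel

open Finset Matrix

/-! ## 1. Zeta windows and the unit-weight stage matrices -/

/-- The ZETA WINDOW `Z(i,c)[j,m] = [bits j ⊆ bits (c + m)]` (`j, m < i`): the Boolean inclusion matrix with
rows the first `i` codes and columns the `i` consecutive codes starting at `c`. -/
def zetaWindow (i c : ℕ) : Matrix (Fin i) (Fin i) ℤ :=
  Matrix.of fun j m => if bits (j : ℕ) ⊆ bits (c + (m : ℕ)) then 1 else 0

/-- Entries of the zeta window. -/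
theorem zetaWindow_apply (i c : ℕ) (j m : Fin i) :
    zetaWindow i c j m = if bits (j : ℕ) ⊆ bits (c + (m : ℕ)) then 1 else 0 := rfl

/-- The stage-`i` matrix of the hierarchical Moore peel with UNIT weights (`exp` kernel):
`Z_i[j,m] = [T_j ⊆ T_{c_i + m}]`, `c_i = windowStart i`. -/
def zetaPeelMatrix (i : ℕ) : Matrix (Fin i) (Fin i) ℤ := zetaWindow i (windowStart i)

/-- Entries of the unit-weight stage matrix. -/
theorem zetaPeelMatrix_apply (i : ℕ) (j m : Fin i) :
    zetaPeelMatrix i j m = if bits (j : ℕ) ⊆ bits (windowStart i + (m : ℕ)) then 1 else 0 := rfl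

/-- The factorial stage matrix `G_i` of `…MooreBench` and the unit-weight stage matrix `Z_i` have the
same support: `G_i[j,m] ≠ 0 ↔ Z_i[j,m] = 1`. -/
theorem peelMatrix_ne_zero_iff (i : ℕ) (j m : Fin i) :
    peelMatrix i j m ≠ 0 ↔ zetaPeelMatrix i j m = 1 := by
  rw [peelMatrix_apply, zetaPeelMatrix_apply]
  by_cases hsub : bits (j : ℕ) ⊆ bits (windowStart i + (m : ℕ))
  · rw [if_pos hsub, if_pos hsub]
    simp only [ne_eq, Nat.cast_eq_zero, iff_true]
    exact Nat.factorial_ne_zero _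
  · rw [if_neg hsub, if_neg hsub]
    simp

/-- `Z_i[j,m] = [G_i[j,m] ≠ 0]`. -/
theorem zetaPeelMatrix_eq_support (i : ℕ) (j m : Fin i) :
    zetaPeelMatrix i j m = if peelMatrix i j m ≠ 0 then 1 else 0 := by
  rw [peelMatrix_apply, zetaPeelMatrix_apply]
  by_cases hsub : bits (j : ℕ) ⊆ bits (windowStart i + (m : ℕ))
  · rw [if_pos hsub, if_pos hsub, if_pos]
    exact_mod_cast Nat.factorial_ne_zero _
  · rw [if_neg hsub, if_neg hsub, if_neg]
    exact fun h => h rfl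

/-! ## 2. Bit-set lemmas: low bits and the bit `k` -/

/-- For `j < 2^k`, the containment `bits j ⊆ bits x` only depends on `x mod 2^k`. -/
theorem bits_subset_iff_of_mod_eq {j k x y : ℕ} (hj : j < 2 ^ k) (hxy : x % 2 ^ k = y % 2 ^ k) :
    bits j ⊆ bits x ↔ bits j ⊆ bits y := by
  suffices h : ∀ x y : ℕ, x % 2 ^ k = y % 2 ^ k → bits j ⊆ bits x → bits j ⊆ bits y from
    ⟨h x y hxy, h y x hxy.symm⟩
  intro x y hxy hsub t ht
  have htk : t < k := lt_of_mem_bits hj ht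
  have hx : x.testBit t = true := mem_bits.mp (hsub ht)
  rw [mem_bits]
  have e1 : (x % 2 ^ k).testBit t = (y % 2 ^ k).testBit t := by rw [hxy]
  rw [Nat.testBit_mod_two_pow, Nat.testBit_mod_two_pow, decide_eq_true htk, Bool.true_and,
    Bool.true_and, hx] at e1
  exact e1.symm

/-- `bits (2^k + j) = insert k (bits j)` for `j < 2^k`. -/
theorem bits_two_pow_add {j k : ℕ} (hj : j < 2 ^ k) : bits (2 ^ k + j) = insert k (bits j) := by
  ext t
  rw [Finset.mem_insert, mem_bits, mem_bits]
  have e : 2 ^ k + j = 2 ^ k ||| j := by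
    have := Nat.two_pow_add_eq_or_of_lt hj 1
    simpa using this
  rw [e, Nat.testBit_or, Nat.testBit_two_pow, Bool.or_eq_true, decide_eq_true_eq, eq_comm]

/-- For `j < 2^k`: `bits (2^k + j) ⊆ bits x ↔ (bit k of x) ∧ bits j ⊆ bits x`. -/
theorem bits_two_pow_add_subset_iff {j k x : ℕ} (hj : j < 2 ^ k) :
    bits (2 ^ k + j) ⊆ bits x ↔ x.testBit k = true ∧ bits j ⊆ bits x := by
  rw [bits_two_pow_add hj, Finset.insert_subset_iff, mem_bits]

/-- Adding `2^k` flips the bit `k`. -/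
theorem testBit_add_two_pow_self (x k : ℕ) : (x + 2 ^ k).testBit k = !x.testBit k := by
  rw [add_comm, Nat.testBit_two_pow_add_eq]

/-! ## 3. The block step `|det Z(2^k + s, c)| = |det Z(2^k, c)| · |det Z(s, c)|` (`s ≤ 2^k`) -/

section Step

variable (k c s : ℕ) (hs : s ≤ 2 ^ k)

/-- The column twist on `Fin (2^k) ⊕ Fin s` (read as the columns `m` and `2^k + j'` of the window): for
each pair `{m, m + 2^k}` (`m < s`) it puts the member whose code `c + ·` has bit `k` ABSENT in the first
summand and the member with bit `k` PRESENT in the second summand; columns `s ≤ m < 2^k` are fixed. -/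
def colTwist : Fin (2 ^ k) ⊕ Fin s → Fin (2 ^ k) ⊕ Fin s
  | Sum.inl m => if h : (m : ℕ) < s ∧ (c + (m : ℕ)).testBit k = true then Sum.inr ⟨m, h.1⟩
      else Sum.inl m
  | Sum.inr j => if (c + (j : ℕ)).testBit k = true then Sum.inl (Fin.castLE hs j) else Sum.inr j

/-- The twist on the first summand (definitional unfolding). -/
theorem colTwist_inl (m : Fin (2 ^ k)) :
    colTwist k c s hs (Sum.inl m) =
      if h : (m : ℕ) < s ∧ (c + (m : ℕ)).testBit k = true then Sum.inr ⟨m, h.1⟩ else Sum.inl m := rfl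

/-- The twist on the second summand (definitional unfolding). -/
theorem colTwist_inr (j : Fin s) :
    colTwist k c s hs (Sum.inr j) =
      if (c + (j : ℕ)).testBit k = true then Sum.inl (Fin.castLE hs j) else Sum.inr j := rfl

/-- The column twist is an involution. -/
theorem colTwist_involutive : Function.Involutive (colTwist k c s hs) := by
  rintro (m | j)
  · by_cases h : (m : ℕ) < s ∧ (c + (m : ℕ)).testBit k = true
    · rw [colTwist_inl, dif_pos h, colTwist_inr, if_pos h.2]
      rfl
    · rw [colTwist_inl, dif_neg h, colTwist_inl, dif_neg h]
  · by_cases h : (c + (j : ℕ)).testBit k = true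
    · rw [colTwist_inr, if_pos h, colTwist_inl, dif_pos ⟨j.2, h⟩]
      rfl
    · rw [colTwist_inr, if_neg h, colTwist_inr, if_neg h]

/-- The actual column code (in `Fin (2^k + s)`) selected by the twist. -/
def colCode (y : Fin (2 ^ k) ⊕ Fin s) : ℕ := (finSumFinEquiv (colTwist k c s hs y) : ℕ)

/-- First summand: the selected column has the residue of `m` mod `2^k` … -/
theorem colCode_inl_mod (m : Fin (2 ^ k)) :
    (c + colCode k c s hs (Sum.inl m)) % 2 ^ k = (c + (m : ℕ)) % 2 ^ k := by
  rw [colCode, colTwist_inl]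
  by_cases h : (m : ℕ) < s ∧ (c + (m : ℕ)).testBit k = true
  · rw [dif_pos h, finSumFinEquiv_apply_right, Fin.val_natAdd, ← add_assoc, add_right_comm,
      Nat.add_mod_right]
  · rw [dif_neg h, finSumFinEquiv_apply_left, Fin.val_castAdd]

/-- … and, for `m < s`, bit `k` absent. -/
theorem testBit_colCode_inl (m : Fin (2 ^ k)) (hm : (m : ℕ) < s) :
    (c + colCode k c s hs (Sum.inl m)).testBit k = false := by
  rw [colCode, colTwist_inl]
  by_cases h : (m : ℕ) < s ∧ (c + (m : ℕ)).testBit k = true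
  · rw [dif_pos h, finSumFinEquiv_apply_right, Fin.val_natAdd, ← add_assoc, add_right_comm,
      testBit_add_two_pow_self, h.2]
    rfl
  · rw [dif_neg h, finSumFinEquiv_apply_left, Fin.val_castAdd]
    simpa [hm] using h

/-- Second summand: the selected column has the residue of `j` mod `2^k` … -/
theorem colCode_inr_mod (j : Fin s) :
    (c + colCode k c s hs (Sum.inr j)) % 2 ^ k = (c + (j : ℕ)) % 2 ^ k := by
  rw [colCode, colTwist_inr]
  by_cases h : (c + (j : ℕ)).testBit k = true
  · rw [if_pos h, finSumFinEquiv_apply_left, Fin.val_castAdd, Fin.val_castLE]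
  · rw [if_neg h, finSumFinEquiv_apply_right, Fin.val_natAdd, ← add_assoc, add_right_comm,
      Nat.add_mod_right]

/-- … and bit `k` present. -/
theorem testBit_colCode_inr (j : Fin s) :
    (c + colCode k c s hs (Sum.inr j)).testBit k = true := by
  rw [colCode, colTwist_inr]
  by_cases h : (c + (j : ℕ)).testBit k = true
  · rw [if_pos h, finSumFinEquiv_apply_left, Fin.val_castAdd, Fin.val_castLE, h]
  · rw [if_neg h, finSumFinEquiv_apply_right, Fin.val_natAdd, ← add_assoc, add_right_comm,
      testBit_add_two_pow_self]
    simpa using h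

/-- The reindexed window: rows `Fin (2^k) ⊕ Fin s` in order, columns twisted. -/
def twisted : Matrix (Fin (2 ^ k) ⊕ Fin s) (Fin (2 ^ k) ⊕ Fin s) ℤ :=
  (zetaWindow (2 ^ k + s) c).submatrix finSumFinEquiv
    (fun y => finSumFinEquiv (colTwist k c s hs y))

/-- Entries of the reindexed window. -/
theorem twisted_apply (x y : Fin (2 ^ k) ⊕ Fin s) :
    twisted k c s hs x y =
      if bits ((finSumFinEquiv x : Fin (2 ^ k + s)) : ℕ) ⊆ bits (c + colCode k c s hs y)
      then 1 else 0 := rfl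

/-- `|det|` is unchanged by the reindexing. -/
theorem natAbs_det_twisted :
    (twisted k c s hs).det.natAbs = (zetaWindow (2 ^ k + s) c).det.natAbs := by
  have e := Matrix.abs_det_submatrix_equiv_equiv (R := ℤ) finSumFinEquiv
    (((colTwist_involutive k c s hs).toPerm _).trans finSumFinEquiv) (zetaWindow (2 ^ k + s) c)
  rw [Int.abs_eq_natAbs, Int.abs_eq_natAbs, Nat.cast_inj] at e
  rw [← e]
  rfl

/-- Low rows × first columns: `Z(2^k, c)`. -/
theorem twisted_inl_inl (j m : Fin (2 ^ k)) :
    twisted k c s hs (Sum.inl j) (Sum.inl m) = zetaWindow (2 ^ k) c j m := by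
  rw [twisted_apply, zetaWindow_apply, finSumFinEquiv_apply_left, Fin.val_castAdd]
  exact if_congr (bits_subset_iff_of_mod_eq j.2 (colCode_inl_mod k c s hs m)) rfl rfl

/-- Low rows × second columns: the columns `j' < s` of `Z(2^k, c)` again. -/
theorem twisted_inl_inr (j : Fin (2 ^ k)) (j' : Fin s) :
    twisted k c s hs (Sum.inl j) (Sum.inr j') = zetaWindow (2 ^ k) c j (Fin.castLE hs j') := by
  rw [twisted_apply, zetaWindow_apply, finSumFinEquiv_apply_left, Fin.val_castAdd, Fin.val_castLE]
  exact if_congr (bits_subset_iff_of_mod_eq j.2 (colCode_inr_mod k c s hs j')) rfl rfl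

/-- High rows × first columns `m < s`: zero (bit `k` is in the row code but not in the column code). -/
theorem twisted_inr_inl (j₁ : Fin s) (m : Fin (2 ^ k)) (hm : (m : ℕ) < s) :
    twisted k c s hs (Sum.inr j₁) (Sum.inl m) = 0 := by
  rw [twisted_apply, finSumFinEquiv_apply_right, Fin.val_natAdd, if_neg]
  intro hsub
  have h1 := ((bits_two_pow_add_subset_iff (lt_of_lt_of_le j₁.2 hs)).mp hsub).1
  rw [testBit_colCode_inl k c s hs m hm] at h1
  exact Bool.false_ne_true h1

/-- High rows × second columns: `Z(s, c)`. -/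
theorem twisted_inr_inr (j₁ j' : Fin s) :
    twisted k c s hs (Sum.inr j₁) (Sum.inr j') = zetaWindow s c j₁ j' := by
  rw [twisted_apply, zetaWindow_apply, finSumFinEquiv_apply_right, Fin.val_natAdd]
  refine if_congr ?_ rfl rfl
  rw [bits_two_pow_add_subset_iff (lt_of_lt_of_le j₁.2 hs), testBit_colCode_inr k c s hs j',
    bits_subset_iff_of_mod_eq (lt_of_lt_of_le j₁.2 hs) (colCode_inr_mod k c s hs j')]
  exact ⟨fun h => h.2, fun h => ⟨rfl, h⟩⟩

/-- The first `s` columns of the identity of size `2^k`. -/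
def firstCols : Matrix (Fin (2 ^ k)) (Fin s) ℤ :=
  Matrix.of fun m j' => if m = Fin.castLE hs j' then 1 else 0

/-- Right multiplication by `firstCols` selects the first `s` columns. -/
theorem mul_firstCols_apply {ι : Type*} (A : Matrix ι (Fin (2 ^ k)) ℤ) (x : ι) (j' : Fin s) :
    (A * firstCols k s hs) x j' = A x (Fin.castLE hs j') := by
  simp [Matrix.mul_apply, firstCols, Finset.sum_ite_eq']

/-- **The block step**: after the unipotent block column operation the twisted window is block
lower-triangular with diagonal blocks `Z(2^k, c)` and `Z(s, c)`. -/
theorem twisted_mul_unipotent :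
    twisted k c s hs * Matrix.fromBlocks 1 (-firstCols k s hs) 0 1 =
      Matrix.fromBlocks (zetaWindow (2 ^ k) c) 0 (twisted k c s hs).toBlocks₂₁ (zetaWindow s c) := by
  conv_lhs => rw [← Matrix.fromBlocks_toBlocks (twisted k c s hs)]
  rw [Matrix.fromBlocks_multiply]
  simp only [Matrix.mul_one, Matrix.mul_zero, add_zero, Matrix.mul_neg]
  congr 1
  · ext j m
    exact twisted_inl_inl k c s hs j m
  · ext j j'
    rw [Matrix.add_apply, Matrix.neg_apply, mul_firstCols_apply, Matrix.zero_apply]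
    change -twisted k c s hs (Sum.inl j) (Sum.inl (Fin.castLE hs j')) +
      twisted k c s hs (Sum.inl j) (Sum.inr j') = 0
    rw [twisted_inl_inl, twisted_inl_inr, neg_add_cancel]
  · ext j₁ j'
    rw [Matrix.add_apply, Matrix.neg_apply, mul_firstCols_apply]
    change -twisted k c s hs (Sum.inr j₁) (Sum.inl (Fin.castLE hs j')) +
      twisted k c s hs (Sum.inr j₁) (Sum.inr j') = zetaWindow s c j₁ j'
    rw [twisted_inr_inl k c s hs j₁ _ (by simp), twisted_inr_inr, neg_zero, zero_add]

/-- Hence `det (twisted) = det Z(2^k, c) · det Z(s, c)`. -/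
theorem det_twisted :
    (twisted k c s hs).det = (zetaWindow (2 ^ k) c).det * (zetaWindow s c).det := by
  have e := congrArg Matrix.det (twisted_mul_unipotent k c s hs)
  rw [Matrix.det_mul, Matrix.det_fromBlocks_zero₂₁, Matrix.det_one, Matrix.det_one, mul_one,
    mul_one, Matrix.det_fromBlocks_zero₁₂] at e
  exact e

end Step

/-- **The block step for `|det|`**: `|det Z(2^k + s, c)| = |det Z(2^k, c)| · |det Z(s, c)|` for `s ≤ 2^k`. -/
theorem natAbs_det_zetaWindow_step (k c s : ℕ) (hs : s ≤ 2 ^ k) :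
    (zetaWindow (2 ^ k + s) c).det.natAbs =
      (zetaWindow (2 ^ k) c).det.natAbs * (zetaWindow s c).det.natAbs := by
  rw [← natAbs_det_twisted k c s hs, det_twisted, Int.natAbs_mul]

/-! ## 4. LEMMA Z′ -/

/-- `Z(0, c)` is the empty matrix. -/
theorem det_zetaWindow_zero (c : ℕ) : (zetaWindow 0 c).det = 1 := Matrix.det_fin_zero

/-- `Z(1, c) = (1)`: the empty set is contained in every bit-set. -/
theorem det_zetaWindow_one (c : ℕ) : (zetaWindow 1 c).det = 1 := by
  rw [Matrix.det_fin_one, zetaWindow_apply]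
  simp

/-- LEMMA Z′ below a power of two (induction on the exponent). -/
theorem natAbs_det_zetaWindow_of_le (k : ℕ) :
    ∀ i ≤ 2 ^ k, ∀ c : ℕ, (zetaWindow i c).det.natAbs = 1 := by
  induction k with
  | zero =>
    intro i hi c
    interval_cases i
    · rw [det_zetaWindow_zero]
      rfl
    · rw [det_zetaWindow_one]
      rfl
  | succ k ih =>
    intro i hi c
    by_cases hik : i ≤ 2 ^ k
    · exact ih i hik c
    · obtain ⟨s, rfl⟩ : ∃ s, i = 2 ^ k + s := ⟨i - 2 ^ k, by omega⟩
      have hs : s ≤ 2 ^ k := by rw [pow_succ] at hi; omega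
      rw [natAbs_det_zetaWindow_step k c s hs, ih _ le_rfl c, ih s hs c]

/-- **LEMMA Z′ (memo g25 §4bis).**  Every zeta window is unimodular: `|det Z(i,c)| = 1` for all `i, c` —
every minor of `ζ_b = ⊗^b (1 1; 0 1)` with rows an initial segment of codes and columns a window of
consecutive codes (a cyclic interval of `ℤ/2^b`) has determinant `±1`. -/
theorem natAbs_det_zetaWindow (i c : ℕ) : (zetaWindow i c).det.natAbs = 1 :=
  natAbs_det_zetaWindow_of_le i i Nat.lt_two_pow_self.le c

/-- LEMMA Z′, unit form. -/
theorem isUnit_det_zetaWindow (i c : ℕ) : IsUnit (zetaWindow i c).det :=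
  Int.isUnit_iff_natAbs_eq.mpr (natAbs_det_zetaWindow i c)

/-- LEMMA Z′, sign form: `det Z(i,c) = 1 ∨ det Z(i,c) = -1`. -/
theorem det_zetaWindow_eq_one_or (i c : ℕ) :
    (zetaWindow i c).det = 1 ∨ (zetaWindow i c).det = -1 :=
  Int.isUnit_iff.mp (isUnit_det_zetaWindow i c)

/-- LEMMA Z′, nonvanishing form. -/
theorem det_zetaWindow_ne_zero (i c : ℕ) : (zetaWindow i c).det ≠ 0 :=
  (isUnit_det_zetaWindow i c).ne_zero

/-! ## 5. The unit-weight peel never stops -/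

/-- `|det Z_i| = 1` for every stage `i`. -/
theorem natAbs_det_zetaPeelMatrix (i : ℕ) : (zetaPeelMatrix i).det.natAbs = 1 :=
  natAbs_det_zetaWindow i (windowStart i)

/-- **`det Z_i ≠ 0` for every `i`** — in contrast with the factorial stage matrices (`det G_183 = 0`,
`…MooreBenchStop`), the unit-weight stage matrices of the hierarchical Moore peel are all nonsingular. -/
theorem det_zetaPeelMatrix_ne_zero (i : ℕ) : (zetaPeelMatrix i).det ≠ 0 :=
  det_zetaWindow_ne_zero i (windowStart i)

/-- In particular at the first bad stage of the factorial peel: `|det Z_183| = 1` while `det G_183 = 0`. -/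
theorem natAbs_det_zetaPeelMatrix_183 : (zetaPeelMatrix 183).det.natAbs = 1 :=
  natAbs_det_zetaPeelMatrix 183

end Summit.ValiantsHypothesis.ValiantsHypothesis.Theorems.BarrierLever.MoorePeel
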